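import Summits.RiemannHypothesis.RiemannHypothesis.Theorems.IntegerScrewRung512
import Summits.RiemannHypothesis.RiemannHypothesis.Theorems.IntegerScrewPivotUpperBound
import Summits.RiemannHypothesis.RiemannHypothesis.Theorems.IntegerScrewPivotLogBound
import Summits.RiemannHypothesis.RiemannHypothesis.Theorems.IntegerScrewFloorOfRH
import Literature.Analysis.Matrix.SchurComplementConditioning
import HarnessLib

/-!
# Integer screw ladder — the pivot is a SCHUR COMPLEMENT: quadratic-form floors pass to the pivot (RH-free), and
# RH ⟹ a POLYNOMIAL PIVOT FLOOR `c·M^{−A} ≤ d_M` (two-sided pivot window under RH)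

Cell rh-split, seat rh-split-screw-neg g3 (brief sha16 f79c5f09d8bcb036), card `run/shared/lean/pub/rh-split/cards/SPLIT-screw-neg.md`
gen-3 addendum (row B26 of g2 «RH ⟹ d_M ≥ c·M^{−A}», then a hand-on; now kernel); zero-definition raw form of the
Schur-complement section of `HOME/rh-split-screw-neg/SplitScrewNegG3.lean` (sha16 c2db1903cb50a2d2; the seat-local `FormFloor μ M` /
`PivotPowerFloor` spelled out; proofs verbatim), filed by rh-split-typer-1 g2 on the lead's queue T1-Q2 (rh-split-lead g2,
2026-08-26T23:22Z).

* `blockForm_eq`, `schur_entry_eq_screwPivot` — the level-`(n+1)` screw form is the bordered block form of `S_n`, and the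
  `(0,0)` entry of the `1×1` Schur complement of `S_n` in `S_{n+1}` is the pivot `d_{n+2} = screwDet (n+1) / screwDet n`;
* `floor_le_screwPivot` — **pivot ≥ form floor (RH-FREE)**: if `S_n ≻ 0` and the level-`(n+2)` screw form satisfies
  `μ·Σ x² ≤ Q_{n+2}(x)` (`μ ≥ 0`), then `μ ≤ d_{n+2}` (the Schur complement inherits Rayleigh lower bounds —
  `Literature.Analysis.Matrix.SchurConditioning.rayleigh_lower_schur` [Axelsson 1994, Lemma 3.12 (b)]);
  `floor_le_screwPivot_of_rh` — along the RH ladder every form floor is a pivot floor;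
* `pivotPowerFloor_of_rh` — **RH ⟹ `∃ A c > 0, ∀ M ≥ 2, c·M^{−A} ≤ d_M`** (`A` the inexplicit exponent of the tree's
  `floorOfRH_proof`); `rh_pivot_window` — RH ⟹ `c·M^{−A} ≤ d_M ≤ (log M + 4)/(M − 1)` for `M ≥ 3`.

Use in the cell: the decay-side tails of the (screw, neg) census (geometric / exponential / power decay, `CostumeDetectorsScrewII/III`
and the seat's g3 rows B27–B32) are RH-INCONSISTENT through this window.  Deliberately NOT here: the g3 Gundelfinger
sharpening B23′ (`rh_iff_detNonneg_and_noConsecZero`; it carries matrix-valued definitions `screwBorder₂` / `screwCorner₂`).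
Typer replay (rh-split-typer-1 g2): the seat's scratch rc 0 / 0 warnings / 0 sorry with std axioms on `floor_le_screwPivot`,
`pivotPowerFloor_of_rh` (AxCheck-SplitScrewNegG3.md); this raw form re-checked the same.

HONEST LABEL: SPLITTING SEARCH over kernel-typed RH-EQUIVALENCES; a splitting A ∧ B ⟹ RH is CONDITIONAL bookkeeping unless
A and B are both proved; the RH ⟹ statements here are consequences of RH, and nothing here bears on the truth of RH.
-/

noncomputable section

set_option linter.dupNamespace false

namespace Summit.RiemannHypothesis.RiemannHypothesis.Theorems.IntegerScrew.PivotFloorOfRH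

open Literature.NumberTheory.LFunctions Matrix Filter Topology
open Summit.RiemannHypothesis.RiemannHypothesis.Theorems.IntegerScrew
open Summit.RiemannHypothesis.RiemannHypothesis.Theorems (floorOfRH_proof)
open Literature.Analysis.Matrix.SchurConditioning

/-! ## The pivot is a Schur complement: quadratic-form floors pass to the pivot (RH-free) -/

/-- The bordered block matrix of `S_n` is `S_{n+1}` re-indexed. [folklore] -/
theorem blockMat_eq_submatrix (n : ℕ) :
    blockMat (screwMatrix n) (screwBorder n) (screwCorner n) =
      (screwMatrix (n + 1)).submatrix finSumFinEquiv finSumFinEquiv := by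
  rw [screwMatrix_succ_submatrix, blockMat, conjTranspose_eq_transpose_of_trivial]

/-- The quadratic form of the bordered block matrix is the level-`(n+1)` screw form. -/
theorem blockForm_eq (n : ℕ) (v : Fin (n + 1) → ℝ) :
    (v ∘ finSumFinEquiv) ⬝ᵥ
        (blockMat (screwMatrix n) (screwBorder n) (screwCorner n) *ᵥ (v ∘ finSumFinEquiv)) =
      v ⬝ᵥ (screwMatrix (n + 1) *ᵥ v) := by
  rw [blockMat_eq_submatrix, submatrix_mulVec_equiv]
  have hve : (v ∘ ⇑finSumFinEquiv) ∘ ⇑(finSumFinEquiv (m := n) (n := 1)).symm = v := by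
    funext i; simp
  rw [hve, comp_equiv_dotProduct_comp_equiv]

/-- The `(0,0)` entry of the 1×1 Schur complement of `S_{n}` in `S_{n+1}` is the pivot
`d_{n+2} = screwDet (n+1) / screwDet n`. -/
theorem schur_entry_eq_screwPivot (n : ℕ) (hn : (screwMatrix n).PosDef) :
    schur (screwMatrix n) (screwBorder n) (screwCorner n) 0 0 = screwPivot (n + 2) := by
  letI : Invertible (screwMatrix n) := hn.isUnit.invertible
  have hdn : 0 < screwDet n := hn.det_pos
  have hdet := screwDet_succ n
  rw [conjTranspose_eq_transpose_of_trivial] at hdet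
  rw [screwPivot_add_two, hdet, mul_div_cancel_left₀ _ hdn.ne', Matrix.det_fin_one]
  rfl

/-- **Pivot ≥ form floor** (RH-free).  If `S_n` is positive definite and the level-`(n+2)`
screw form satisfies `μ·Σ x² ≤ Q_{n+2}(x)` with `μ ≥ 0`, then `μ ≤ d_{n+2}`.
Source: the Schur complement inherits Rayleigh lower bounds,
`Literature.Analysis.Matrix.SchurConditioning.rayleigh_lower_schur` [Axelsson 1994, Lemma 3.12 (b)]. -/
theorem floor_le_screwPivot (n : ℕ) (hn : (screwMatrix n).PosDef) {μ : ℝ} (hμ : 0 ≤ μ)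
    (hfl : ∀ x : ℕ → ℝ, μ * ∑ m ∈ Finset.Icc 2 (n + 2), x m ^ 2 ≤
      ∑ m ∈ Finset.Icc 2 (n + 2), ∑ m' ∈ Finset.Icc 2 (n + 2),
        zetaScrewKernel (Real.log m) (Real.log m') * (x m * x m')) :
    μ ≤ screwPivot (n + 2) := by
  have hM : ∀ z : Fin n ⊕ Fin 1 → ℝ,
      μ * (z ⬝ᵥ z) ≤ z ⬝ᵥ (blockMat (screwMatrix n) (screwBorder n) (screwCorner n) *ᵥ z) := by
    intro z
    obtain ⟨v, rfl⟩ : ∃ v : Fin (n + 1) → ℝ, z = v ∘ finSumFinEquiv :=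
      ⟨z ∘ finSumFinEquiv.symm, by funext i; simp⟩
    rw [comp_equiv_dotProduct_comp_equiv, blockForm_eq]
    -- an `ℕ`-indexed extension of `v`
    let v' : ℕ → ℝ := fun k => if h : k < n + 1 then v ⟨k, h⟩ else 0
    let x : ℕ → ℝ := fun m => v' (m - 2)
    have hx : ∀ i : Fin (n + 1), x ((i : ℕ) + 2) = v i := by
      intro i
      show v' ((i : ℕ) + 2 - 2) = v i
      rw [add_tsub_cancel_right]
      show (if h : (i : ℕ) < n + 1 then v ⟨i, h⟩ else 0) = v i
      rw [dif_pos i.isLt]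
    have hform := screwMatrix_form_eq_Icc (n + 1) v x hx
    rw [star_trivial] at hform
    have hsq : v ⬝ᵥ v = ∑ m ∈ Finset.Icc 2 (n + 1 + 1), x m ^ 2 := by
      rw [sum_Icc_two_eq_sum_fin, dotProduct]
      exact Finset.sum_congr rfl fun i _ => by simp only [hx]; ring
    rw [hsq, hform]
    exact hfl x
  have key : μ ≤ schur (screwMatrix n) (screwBorder n) (screwCorner n) 0 0 := by
    have h := rayleigh_lower_schur hn.1 hn.isUnit (screwBorder n) (screwCorner n) hμ hM
      fun _ => 1
    simpa [dotProduct, mulVec] using h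
  rwa [schur_entry_eq_screwPivot n hn] at key

/-- The same at level `M ≥ 2` along the RH ladder: RH ⇒ every form floor is a pivot floor. -/
theorem floor_le_screwPivot_of_rh (hRH : _root_.RiemannHypothesis) (M : ℕ) (hM : 2 ≤ M)
    {μ : ℝ} (hμ : 0 ≤ μ)
    (hfl : ∀ x : ℕ → ℝ, μ * ∑ m ∈ Finset.Icc 2 M, x m ^ 2 ≤
      ∑ m ∈ Finset.Icc 2 M, ∑ m' ∈ Finset.Icc 2 M,
        zetaScrewKernel (Real.log m) (Real.log m') * (x m * x m')) :
    μ ≤ screwPivot M := by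
  obtain ⟨n, rfl⟩ : ∃ n, M = n + 2 := ⟨M - 2, by omega⟩
  exact floor_le_screwPivot n (screwMatrix_posDef_of_riemannHypothesis hRH n) hμ hfl

/-! ## RH-side lower window (census row B26, now kernel) -/

/-- **RH ⇒ polynomial pivot floor**: `∃ A c > 0, ∀ M ≥ 2, c·M^{-A} ≤ d_M`.
(`A` is the inexplicit exponent of `floorOfRH_proof`.) -/
theorem pivotPowerFloor_of_rh (hRH : _root_.RiemannHypothesis) :
    ∃ A c : ℝ, 0 < c ∧ ∀ M : ℕ, 2 ≤ M → c * (M : ℝ) ^ (-A) ≤ screwPivot M := by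
  obtain ⟨A, c, hc, hfl⟩ := floorOfRH_proof hRH
  refine ⟨A, c, hc, fun M hM => ?_⟩
  have hμ : 0 ≤ c * (M : ℝ) ^ (-A) := by positivity
  exact floor_le_screwPivot_of_rh hRH M hM hμ fun x => hfl M x

/-- **RH ⇒ two-sided pivot window**: `c·M^{-A} ≤ d_M ≤ (log M + 4)/(M - 1)` for `M ≥ 3`. -/
theorem rh_pivot_window (hRH : _root_.RiemannHypothesis) :
    ∃ A c : ℝ, 0 < c ∧ ∀ M : ℕ, 3 ≤ M →
      c * (M : ℝ) ^ (-A) ≤ screwPivot M ∧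
        screwPivot M ≤ (Real.log M + 4) / ((M : ℝ) - 1) := by
  obtain ⟨A, c, hc, h⟩ := pivotPowerFloor_of_rh hRH
  exact ⟨A, c, hc, fun M hM =>
    ⟨h M (by omega), (screwPivot_le_log_div_of_riemannHypothesis hRH M hM).2⟩⟩

end Summit.RiemannHypothesis.RiemannHypothesis.Theorems.IntegerScrew.PivotFloorOfRH

end
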